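/-
Copyright (c) 2026 the pub-hodgecm-mathlib formalisation cell (harness21).  Prover seat hodgecm-mathlib-K2E3-p06 (g6) (E3 hand lent to L1; LEAD F0P6-plan (g14); desk K2E3-p14 (g9)
ruling 2026-09-05T00:01:43Z «K2E3-p06 NEXT = `K2LiuRankOneWhittakerGammaLetterKw`, the `K_w` repackaging of both Γ-letters into ★ W-FE-3's `(Γt, hΓ, hΓreg, hΓ0)`»),
Track B «K2-LIT» ∕ hLiu418 = stmt-HodgeConjecture-24832: U1-CT-ind stage 3, brick B2a′ (the rank-one ψ-Whittaker functional equation), file W-FE-4.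
THEOREMS ONLY (no `def`∕`instance`∕notation∕`sorry`).
-/
import Summits.HodgeConjecture.HodgeConjecture.Theorems.K2LiuTwistedGammaFactorLetterRamified   -- ★ p863371 (W-FE-2c, this seat); brings ★ p863232 `K2LiuTwistedGammaFactorLetter` (W-FE-2b, LH7-p06 (g2)) + Lit. Tate files
import Summits.HodgeConjecture.HodgeConjecture.Theorems.K2LiuRankOneFamilies                    -- ★ B6 (K2Liu-p09 (g5)): `lFactor_sub_one`, `isQRationalRegularAt_cpow_one_sub_of_affine`, `IsQRationalRegularAt.pow`; brings ★ F1 `K2LiuQRationalDefs`, ★ T1 `K2LiuLocalLFactorDefs`, ★ (a) `K2LiuQRationalLFactor`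
import Summits.HodgeConjecture.HodgeConjecture.Theorems.K2LiuRankOneLevelHolomorphy             -- ★ B5 (K2Liu-p09 (g5)): `isUnramifiedChar_iff_normAbs`, `normAbs_unifAt`
import HarnessLib

/-!
# Crux `HLiu418`, organ U1-CT-ind STAGE 3 («U1-glob»), brick B2a′, file W-FE-4: THE Γ-LETTERS AT A COMPLETION `K_w`, IN ★ W-FE-3's CURRENCY —
# `∃ Γt N₀, (∀ M ≥ N₀, ∀ s, 1 < re s → ∫_{x ∉ 𝔭^M} T_s(x) ψ(σκ x⁻¹) dμ(x) = L(e(s) − 1, ν) · Γt s) ∧ Γt regular at ½ ∧ Γt(½) ≠ 0` at EVERY finite place (`ν` unramified or not)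
# [Tate1950 §2.5; CasselmanShalika1980 §4; Casselman1980 §3; GanTakeda2011SiegelWeil §7 Lemma 7.4]

Cell `hodgecm-mathlib`, crux item hLiu418 = `stmt-HodgeConjecture-24832`; squad K2, strike line L1, LEAD F0P6-plan (g14); desk K2E3-p14 (g9) + K2Liu-p13 (g4);
prover K2E3-p06 (g6).  Lane `--supports stmt-HodgeConjecture-24832 --as helper` (count-neutral).

THE POINT.  ★ W-FE-3 (`K2LiuRankOneWhittakerFECentre.twistedHeadSum_half_eq_zero_of_normalised_half_eq_zero`, this seat) and its consumer, the `hN₃` producer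
`K2LiuLocalKernelN3OfGammaLetter` (LH7-p06 (g2), LEAD BATCH #166 (2)), take the scalar of the rank-one ψ-Whittaker functional equation through ONE evaluation letter with a threshold:
`(Γt : ℂ → ℂ) (N₀ : ℤ) (hΓ : ∀ M, N₀ ≤ M → ∀ s, 1 < s.re → ∫_{x ∉ 𝔭^M} T s x · ψ(σ(κx⁻¹)) dμ = lFactor K w ν (e(s) − 1) · Γt s) (hΓreg : IsQRationalRegularAt q_w ½ Γt) (hΓ0 : Γt ½ ≠ 0)`,
`e(s) = ae·s + ce`, `T s x = C₀ s · ν(x)⁻¹ · ‖x‖^{−e(s)}`.  The group-free evaluations exist at every finite place: ★ p863232 (W-FE-2b, UNRAMIFIED unitary `ν`: `Γ = C₀ μ(𝒪) X^{m′−1}(X − q⁻¹)(1 − X)⁻¹`,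
`X = ν(ϖ)q^{1−e}`) and ★ p863371 (W-FE-2c, RAMIFIED `ν` of exact conductor exponent `c ≥ 1`: `Γ = C₀ (q^{2−e})^{m′−c} G_c`, `G_c ≠ 0`), `m′ = c_ψ − j_c`, `‖σκ‖ = q^{−j_c}`.  THIS FILE
repackages both at a completion `K_w = w.adicCompletion K` in ★ T1's currency (`lFactor K w ν z = (1 − unramValue ν · q_w^{−z})⁻¹`, `unramValue ν = ν(ϖ_w)` or `0`; ★ `lFactor_sub_one`,
★ `lFactor_of_not`) and ★ F1's (`IsQRationalRegularAt q_w`), and PACKAGES them into the three letters from EXACTLY ★ W-FE-3's own binders `(ν hν ae ce he C₀ T hT cν hνc) {ψ cψ} hcψ`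
plus four scalars the instantiation knows: `hc : ‖σκ‖ = q⁻¹^{j_c}`, `hC₀reg : C₀ regular at ½`, `hC₀0 : C₀ ½ ≠ 0`, `he0 : e(½) = 1` (the rank-one step sits at the centre):
**`exists_gammaLetter : ∃ Γt N₀, hΓ ∧ hΓreg ∧ hΓ0`** — by cases on the conductor exponent of `ν` (★ `QuasiChar.exists_hasConductorExp`; `ν` is continuous because W-FE-3's conductor
letter `hνc` makes it trivial on `U^{c_ν⁺}`): `c = 0` ⇒ unramified ⇒ §2 (`N₀ = j_c + 2 − c_ψ`, `Γt s = C₀ s μ(𝒪) X(s)^{c_ψ−j_c−1}(X(s) − q⁻¹)`, `X(s) = unramValue ν · q^{1−e(s)}`, regular as a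
Laurent monomial in `q^{−s}` (★ `isQRationalRegularAt_cpow_one_sub_of_affine`), `Γt ½ = C₀(½) μ(𝒪) u₀^{k}(u₀ − q⁻¹) ≠ 0` since `‖u₀‖ = 1` at `e(½) = 1`); `c ≥ 1` ⇒ ramified ⇒ §3
(`L = 1` by ★ `lFactor_of_not`, `N₀ = j_c + c + 1 − c_ψ`, `Γt s = C₀ s (q^{2−e(s)})^{c_ψ−j_c−c} G_c`, `Γt ½ ≠ 0` by ★ `gammaRamified_ne_zero`).
* §0 `continuous_of_hasConductorExp` (an additive character with a conductor exponent is locally constant, hence continuous — so W-FE-3's letters need no `Continuous ψ`),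
  `isQRationalRegularAt_zpow` (integer powers of a regular non-vanishing function);
* §1 `continuous_of_conductor_letter`, `not_isUnramifiedChar_of_exact_conductor`, `unramValue_eq_apply_unifAtUnit`, `norm_unramValue_eq_one`;
* §2 unramified: `setIntegral_compl_tail_eq_lFactor_mul_of_isUnramifiedChar` (hΓ), `isQRationalRegularAt_gammaUnram` (hΓreg), `gammaUnram_ne_zero` (hΓ0);
* §3 ramified: `setIntegral_compl_tail_eq_lFactor_mul_of_ramified`, `isQRationalRegularAt_gammaRam`, `gammaRam_ne_zero`;
* §4 **`exists_gammaLetter`** (THE PACKAGE, every finite place).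
References: [Tate1950] J. Tate (1950), §2.5; [CasselmanShalika1980] W. Casselman, J. Shalika, Compositio Math. 41 (1980), §4; [Casselman1980] W. Casselman, Compositio Math. 40
(1980), §3; [GanTakeda2011SiegelWeil] W. T. Gan, S. Takeda (2011), §7 Lemma 7.4; [KudlaSweet1997] S. Kudla, W. J. Sweet, §1.
HONEST LABEL.  Count-neutral helper: `HC_CM` is proved only modulo the 7 printed citations (2 remaining named inputs: hLiu418 = `stmt-HodgeConjecture-24832`,
h413 = `stmt-HodgeConjecture-24833`) until rung 0 closes; B2a′ OPEN modulo the `U(2,2)_v` instantiation of W-FE-3's remaining letters (`hword`, `hT`, `hC₀reg`, `hC₀0`, `hN0`);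
this file closes no socket.
-/

set_option autoImplicit false
set_option linter.dupNamespace false -- the mandated namespace repeats `HodgeConjecture.HodgeConjecture`

noncomputable section

open MeasureTheory Filter Topology Set
open scoped NNReal ENNReal Pointwise
open NumberField IsDedekindDomain
open Literature.NumberTheory.GaloisRepresentations.IsNonarchimedeanLocalField
open Literature.NumberTheory.Automorphic Literature.NumberTheory.Automorphic.LocalFieldHaar
open Summit.HodgeConjecture.HodgeConjecture.Cruxes.HLiu418.K2LiuQRationalDefs
open Summit.HodgeConjecture.HodgeConjecture.Cruxes.HLiu418.K2LiuLocalLFactorDefs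
open Summit.HodgeConjecture.HodgeConjecture.Cruxes.HLiu418.K2LiuQRationalLFactor (norm_unramValue_le_one)
open Summit.HodgeConjecture.HodgeConjecture.Cruxes.HLiu418.K2LiuRankOneFamilies (lFactor_sub_one isQRationalRegularAt_cpow_one_sub_of_affine)
open Summit.HodgeConjecture.HodgeConjecture.Cruxes.HLiu418.K2LiuRankOneLevelHolomorphy (isUnramifiedChar_iff_normAbs normAbs_unifAt)
open Summit.HodgeConjecture.HodgeConjecture.Cruxes.HLiu418.K2LiuTwistedGammaFactorLetter (setIntegral_compl_tail_mul_addChar_mul_inv_eq_closedForm)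
open Summit.HodgeConjecture.HodgeConjecture.Cruxes.HLiu418.K2LiuTwistedGammaFactorLetterRamified
  (continuous_of_trivial_on_unitFiltration setIntegral_compl_tail_mul_addChar_mul_inv_eq_gaussShell gammaRamified_ne_zero)

namespace Summit.HodgeConjecture.HodgeConjecture.Cruxes.HLiu418.K2LiuRankOneWhittakerGammaLetterKw

/-! ## §0 Two group-free lemmas -/

section Generic

variable {F : Type*} [Field F] [ValuativeRel F] [TopologicalSpace F] [IsNonarchimedeanLocalField F]

/-- **an additive character with a conductor exponent is continuous**: `ψ(y + t) = ψ(y)` for `t ∈ 𝔭^m` (open), so `ψ` is locally constant. (So W-FE-3's letters `{ψ} {cψ} hcψ` carry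
the continuity the group-free Γ-letters ★ p863232∕★ p863371 ask for.) [cite: Tate1950, §2.2] [cite: BushnellHenniart2006, §1.7] -/
theorem continuous_of_hasConductorExp {ψ : AddChar F Circle} {m : ℤ} (hm : ψ.HasConductorExp m) : Continuous ψ := by
  have hlc : IsLocallyConstant fun y : F => ψ y := by
    rw [IsLocallyConstant.iff_exists_open]
    intro y
    refine ⟨y +ᵥ primePowBall F m, (isOpen_primePowBall m).vadd _, Set.mem_vadd_set.2 ⟨0, zero_mem_primePowBall _, by simp⟩, ?_⟩
    rintro y' ⟨k, hk, rfl⟩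
    dsimp only
    rw [vadd_eq_add, AddChar.map_add_eq_mul, hm.1 k hk, mul_one]
  exact hlc.continuous

omit [ValuativeRel F] [TopologicalSpace F] [IsNonarchimedeanLocalField F] in
/-- **integer powers of a regular function non-vanishing at `s₀` are regular at `s₀`** (★ F1 closure: `.pow`, `.inv`). [cite: Casselman1980, §3] -/
theorem isQRationalRegularAt_zpow {q : ℕ} {s₀ : ℂ} {φ : ℂ → ℂ} (hφ : IsQRationalRegularAt q s₀ φ) (h0 : φ s₀ ≠ 0) (k : ℤ) :
    IsQRationalRegularAt q s₀ fun s => φ s ^ k := by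
  obtain ⟨n, rfl | rfl⟩ := Int.eq_nat_or_neg k
  · simpa only [zpow_natCast] using hφ.pow n
  · simpa only [zpow_neg, zpow_natCast] using (hφ.pow n).inv (pow_ne_zero n h0)

end Generic

/-! ## §1 At a completion `K_w`: continuity and (un)ramification bookkeeping for `ν` -/

variable {K : Type} [Field K] [NumberField K] {w : HeightOneSpectrum (𝓞 K)}

/-- **W-FE-3's conductor letter makes `ν` continuous**: if `ν u = 1` whenever `‖u‖ = 1` and `u − 1 ∈ 𝔭^{c_ν}` (`c_ν ∈ ℤ`), then `ν` is trivial on `U^{c_ν⁺}`, hence continuous.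
[cite: Tate1950, §2.3] [cite: BushnellHenniart2006, §1.8] -/
theorem continuous_of_conductor_letter (ν : (w.adicCompletion K)ˣ →* ℂˣ) (cν : ℤ)
    (hνc : ∀ x : (w.adicCompletion K)ˣ, normAbs (w.adicCompletion K) (x : w.adicCompletion K) = 1 →
      (x : w.adicCompletion K) - 1 ∈ primePowBall (w.adicCompletion K) cν → ν x = 1) : Continuous ν := by
  refine continuous_of_trivial_on_unitFiltration ν (n := cν.toNat) fun u hu => hνc u hu.1 (mem_primePowBall_iff.2 (hu.2.trans ?_))
  rw [← zpow_natCast]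
  exact zpow_le_zpow_right_of_le_one₀ inv_residueFieldCard_pos inv_residueFieldCard_lt_one.le (Int.self_le_toNat cν)

/-- a character with an EXACT conductor exponent `c_ν ≥ 1` is NOT unramified (`ν ≠ 1` somewhere on `U⁰ = {‖u‖ = 1}`). [cite: Tate1950, §2.3] -/
theorem not_isUnramifiedChar_of_exact_conductor (ν : (w.adicCompletion K)ˣ →* ℂˣ) {cν : ℕ} (hc1 : 1 ≤ cν)
    (hνmin : ∀ b < cν, ∃ u ∈ unitFiltration (w.adicCompletion K) b, ν u ≠ 1) : ¬ IsUnramifiedChar ν := by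
  intro hun
  obtain ⟨u, hu, hne⟩ := hνmin 0 (by omega)
  exact hne (((isUnramifiedChar_iff_normAbs ν).1 hun) u (TateDirect.mem_unitFiltration_zero_iff.1 hu))

/-- `unramValue ν = ν(ϖ_w)` at ★ T1's chosen uniformizer, for unramified `ν`. [cite: Casselman1980, §3] -/
theorem unramValue_eq_apply_unifAtUnit {ν : (w.adicCompletion K)ˣ →* ℂˣ} (hun : IsUnramifiedChar ν) :
    unramValue K w ν = ((ν (unifAtUnit K w) : ℂˣ) : ℂ) := by
  classical
  rw [unramValue, if_pos hun]

/-- `‖unramValue ν‖ = 1` for unramified UNITARY `ν`. [cite: Tate1950, §2.3] -/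
theorem norm_unramValue_eq_one {ν : (w.adicCompletion K)ˣ →* ℂˣ} (hν : ∀ x, ‖((ν x : ℂˣ) : ℂ)‖ = 1) (hun : IsUnramifiedChar ν) :
    ‖unramValue K w ν‖ = 1 := by
  rw [unramValue_eq_apply_unifAtUnit hun, hν]

/-! ## §2 The letter at an UNRAMIFIED `ν` (★ p863232 in ★ T1∕F1 currency) -/

variable [MeasurableSpace (w.adicCompletion K)] [BorelSpace (w.adicCompletion K)] (μ : Measure (w.adicCompletion K)) [μ.IsAddHaarMeasure]

/-- **`hΓ` AT AN UNRAMIFIED PLACE.**  In ★ W-FE-3's letters (`ν` unitary, here unramified; `T s x = C₀ s ν(x)⁻¹ ‖x‖^{−e(s)}`, `e(s) = ae·s + ce`; `ψ` of conductor exponent `c_ψ`;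
`‖σκ‖ = q⁻¹^{j_c}`), for every `M ≥ j_c + 2 − c_ψ` and `1 < re s`:
`∫_{x ∉ 𝔭^M} T s x · ψ(σ(κx⁻¹)) dμ = lFactor K w ν (e(s) − 1) · (C₀ s · μ(𝒪) · X(s)^{c_ψ−j_c−1} · (X(s) − q_w⁻¹))`, `X(s) = unramValue ν · q_w^{1−e(s)}` (★ p863232
`setIntegral_compl_tail_mul_addChar_mul_inv_eq_closedForm` at `ϖ = ϖ_w`, ★ `lFactor_sub_one`). [cite: Tate1950, §2.5] [cite: CasselmanShalika1980, §4] [cite: GanTakeda2011SiegelWeil, §7 Lemma 7.4] -/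
theorem setIntegral_compl_tail_eq_lFactor_mul_of_isUnramifiedChar
    (ν : (w.adicCompletion K)ˣ →* ℂˣ) (hν : ∀ x, ‖((ν x : ℂˣ) : ℂ)‖ = 1) (hun : IsUnramifiedChar ν)
    (ae : ℕ) (ce : ℂ) (he : ∀ s : ℂ, 1 < s.re → 1 < ((ae : ℂ) * s + ce).re) (C₀ : ℂ → ℂ)
    (T : ℂ → w.adicCompletion K → ℂ)
    (hT : ∀ (s : ℂ) (x : (w.adicCompletion K)ˣ), T s x = C₀ s * (((ν x)⁻¹ : ℂˣ) : ℂ) *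
      ((normAbs (w.adicCompletion K) (x : w.adicCompletion K) : ℝ) : ℂ) ^ (-((ae : ℂ) * s + ce)))
    {ψ : AddChar (w.adicCompletion K) Circle} {cψ : ℤ} (hcψ : ψ.HasConductorExp cψ) (σ κ : w.adicCompletion K) {jc : ℤ}
    (hc : normAbs (w.adicCompletion K) (σ * κ) = (residueFieldCard (w.adicCompletion K) : ℝ≥0)⁻¹ ^ jc)
    {M : ℤ} (hM : jc + 2 - cψ ≤ M) {s : ℂ} (hs : 1 < s.re) :
    ∫ x in (primePowBall (w.adicCompletion K) M)ᶜ, T s x * ((ψ (σ * (κ * x⁻¹)) : ℂ)) ∂μ =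
      lFactor K w ν ((ae : ℂ) * s + ce - 1) *
        (C₀ s * (μ.real (primePowBall (w.adicCompletion K) 0) : ℂ) *
          (unramValue K w ν * (residueFieldCard (w.adicCompletion K) : ℂ) ^ (1 - ((ae : ℂ) * s + ce))) ^ (cψ - jc - 1) *
          (unramValue K w ν * (residueFieldCard (w.adicCompletion K) : ℂ) ^ (1 - ((ae : ℂ) * s + ce)) - (residueFieldCard (w.adicCompletion K) : ℂ)⁻¹)) := by
  have hun' := (isUnramifiedChar_iff_normAbs ν).1 hun
  have hϖ : normAbs (w.adicCompletion K) ((unifAtUnit K w : (w.adicCompletion K)ˣ) : w.adicCompletion K) =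
      (residueFieldCard (w.adicCompletion K) : ℝ≥0)⁻¹ := by
    rw [coe_unifAtUnit]; exact normAbs_unifAt
  rw [setIntegral_compl_tail_mul_addChar_mul_inv_eq_closedForm μ ν hν hun' (unifAtUnit K w) hϖ (C₀ s) (he s hs) (T s) (hT s)
      (continuous_of_hasConductorExp hcψ) hcψ σ κ hc (by omega), lFactor_sub_one, ← unramValue_eq_apply_unifAtUnit hun]
  ring

omit [MeasurableSpace (w.adicCompletion K)] [BorelSpace (w.adicCompletion K)] in
/-- **`hΓreg` AT AN UNRAMIFIED PLACE**: `s ↦ C₀ s · V · X(s)^k · (X(s) − q_w⁻¹)` is regular at `s₀` when `C₀` is (`X(s) = unramValue ν · q_w^{1−(ae s+ce)}` is `const · (q_w^{−s})^{ae}`, never `0`;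
★ `isQRationalRegularAt_cpow_one_sub_of_affine`, §0 `isQRationalRegularAt_zpow`). [cite: Casselman1980, §3] [cite: KudlaSweet1997, §1] -/
theorem isQRationalRegularAt_gammaUnram (ν : (w.adicCompletion K)ˣ →* ℂˣ) (hun : IsUnramifiedChar ν) (ae : ℕ) (ce : ℂ) {C₀ : ℂ → ℂ} {s₀ : ℂ}
    (hC₀ : IsQRationalRegularAt (residueFieldCard (w.adicCompletion K)) s₀ C₀) (V : ℂ) (k : ℤ) :
    IsQRationalRegularAt (residueFieldCard (w.adicCompletion K)) s₀ fun s =>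
      C₀ s * V * (unramValue K w ν * (residueFieldCard (w.adicCompletion K) : ℂ) ^ (1 - ((ae : ℂ) * s + ce))) ^ k *
        (unramValue K w ν * (residueFieldCard (w.adicCompletion K) : ℂ) ^ (1 - ((ae : ℂ) * s + ce)) - (residueFieldCard (w.adicCompletion K) : ℂ)⁻¹) := by
  have hq0 : (residueFieldCard (w.adicCompletion K) : ℂ) ≠ 0 := Nat.cast_ne_zero.2 (residueFieldCard_ne_zero _)
  have hX : IsQRationalRegularAt (residueFieldCard (w.adicCompletion K)) s₀ fun s =>
      unramValue K w ν * (residueFieldCard (w.adicCompletion K) : ℂ) ^ (1 - ((ae : ℂ) * s + ce)) :=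
    (isQRationalRegularAt_cpow_one_sub_of_affine (K := K) (w := w) (e := fun s => (ae : ℂ) * s + ce) ae ce (fun _ => rfl) s₀).const_mul _
  have hX0 : unramValue K w ν * (residueFieldCard (w.adicCompletion K) : ℂ) ^ (1 - ((ae : ℂ) * s₀ + ce)) ≠ 0 :=
    mul_ne_zero (unramValue_ne_zero K w hun) (Complex.cpow_ne_zero_iff.2 (Or.inl hq0))
  exact ((hC₀.mul (isQRationalRegularAt_const _ s₀ V)).mul (isQRationalRegularAt_zpow hX hX0 k)).mul
    (hX.sub (isQRationalRegularAt_const _ s₀ _))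

omit [BorelSpace (w.adicCompletion K)] in
/-- **`hΓ0` AT AN UNRAMIFIED PLACE**: at a parameter `s₀` with `e(s₀) = 1` (the centre of the rank-one step) `X(s₀) = unramValue ν = u₀`, `‖u₀‖ = 1`, and
`C₀ s₀ · μ(𝒪) · u₀^k · (u₀ − q_w⁻¹) ≠ 0` as soon as `C₀ s₀ ≠ 0` (`q_w ≥ 2`) — inert (`u₀ = −1`), split (`u₀ = 1`) or any unramified unitary `ν` alike.
[cite: GanTakeda2011SiegelWeil, §7 Lemma 7.4] [cite: CasselmanShalika1980, §4] -/
theorem gammaUnram_ne_zero (ν : (w.adicCompletion K)ˣ →* ℂˣ) (hν : ∀ x, ‖((ν x : ℂˣ) : ℂ)‖ = 1) (hun : IsUnramifiedChar ν) (ae : ℕ) (ce : ℂ)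
    {C₀ : ℂ → ℂ} {s₀ : ℂ} (hC₀0 : C₀ s₀ ≠ 0) (he0 : (ae : ℂ) * s₀ + ce = 1) (k : ℤ) :
    C₀ s₀ * (μ.real (primePowBall (w.adicCompletion K) 0) : ℂ) *
        (unramValue K w ν * (residueFieldCard (w.adicCompletion K) : ℂ) ^ (1 - ((ae : ℂ) * s₀ + ce))) ^ k *
        (unramValue K w ν * (residueFieldCard (w.adicCompletion K) : ℂ) ^ (1 - ((ae : ℂ) * s₀ + ce)) - (residueFieldCard (w.adicCompletion K) : ℂ)⁻¹) ≠ 0 := by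
  rw [he0, sub_self, Complex.cpow_zero, mul_one]
  have hu1 : ‖unramValue K w ν‖ = 1 := norm_unramValue_eq_one hν hun
  have hV : (μ.real (primePowBall (w.adicCompletion K) 0) : ℂ) ≠ 0 := by exact_mod_cast (measureReal_primePowBall_pos μ 0).ne'
  refine mul_ne_zero (mul_ne_zero (mul_ne_zero hC₀0 hV) (zpow_ne_zero _ (unramValue_ne_zero K w hun))) (sub_ne_zero.2 fun h => ?_)
  have hq : (1 : ℝ) < (residueFieldCard (w.adicCompletion K) : ℝ) := by exact_mod_cast one_lt_residueFieldCard (w.adicCompletion K)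
  have h1 : ‖unramValue K w ν‖ = (residueFieldCard (w.adicCompletion K) : ℝ)⁻¹ := by rw [h, norm_inv, Complex.norm_natCast]
  rw [hu1] at h1
  have h2 : (residueFieldCard (w.adicCompletion K) : ℝ) = 1 := by rw [← inv_inv (residueFieldCard (w.adicCompletion K) : ℝ), ← h1, inv_one]
  linarith

/-! ## §3 The letter at a RAMIFIED `ν` (★ p863371 in ★ T1∕F1 currency: `L = 1`) -/

/-- **`hΓ` AT A RAMIFIED PLACE.**  `ν` unitary of EXACT conductor exponent `c_ν ≥ 1`; for every `M ≥ j_c + c_ν + 1 − c_ψ` and `1 < re s`: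
`∫_{x ∉ 𝔭^M} T s x · ψ(σ(κx⁻¹)) dμ = lFactor K w ν (e(s) − 1) · (C₀ s · (q_w^{−(e(s)−2)})^{c_ψ−j_c−c_ν} · G_c)` with `lFactor = 1` (★ `lFactor_of_not`) and the `e`-independent Gauss
integral `G_c = ∫_{𝔭^{c_ψ−j_c−c_ν} ∖ 𝔭^{c_ψ−j_c−c_ν+1}} ψ(σκy) ν̃(y) dμ(y)` (★ p863371 `setIntegral_compl_tail_mul_addChar_mul_inv_eq_gaussShell`). [cite: Tate1950, §2.5] [cite: CasselmanShalika1980, §4] -/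
theorem setIntegral_compl_tail_eq_lFactor_mul_of_ramified
    (ν : (w.adicCompletion K)ˣ →* ℂˣ) (hν : ∀ x, ‖((ν x : ℂˣ) : ℂ)‖ = 1) {cν : ℕ} (hc1 : 1 ≤ cν)
    (hνc : ∀ u ∈ unitFiltration (w.adicCompletion K) cν, ν u = 1) (hνmin : ∀ b < cν, ∃ u ∈ unitFiltration (w.adicCompletion K) b, ν u ≠ 1)
    (ae : ℕ) (ce : ℂ) (he : ∀ s : ℂ, 1 < s.re → 1 < ((ae : ℂ) * s + ce).re) (C₀ : ℂ → ℂ)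
    (T : ℂ → w.adicCompletion K → ℂ)
    (hT : ∀ (s : ℂ) (x : (w.adicCompletion K)ˣ), T s x = C₀ s * (((ν x)⁻¹ : ℂˣ) : ℂ) *
      ((normAbs (w.adicCompletion K) (x : w.adicCompletion K) : ℝ) : ℂ) ^ (-((ae : ℂ) * s + ce)))
    {ψ : AddChar (w.adicCompletion K) Circle} {cψ : ℤ} (hcψ : ψ.HasConductorExp cψ) (σ κ : w.adicCompletion K) {jc : ℤ}
    (hc : normAbs (w.adicCompletion K) (σ * κ) = (residueFieldCard (w.adicCompletion K) : ℝ≥0)⁻¹ ^ jc)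
    {M : ℤ} (hM : jc + cν + 1 - cψ ≤ M) {s : ℂ} (hs : 1 < s.re) :
    ∫ x in (primePowBall (w.adicCompletion K) M)ᶜ, T s x * ((ψ (σ * (κ * x⁻¹)) : ℂ)) ∂μ =
      lFactor K w ν ((ae : ℂ) * s + ce - 1) *
        (C₀ s * ((residueFieldCard (w.adicCompletion K) : ℂ) ^ (-((ae : ℂ) * s + ce - 2))) ^ (cψ - jc - cν) *
          ∫ y in primePowBall (w.adicCompletion K) (cψ - jc - cν) \ primePowBall (w.adicCompletion K) (cψ - jc - cν + 1),
            ((ψ (σ * κ * y)) : ℂ) * Function.extend ((↑) : (w.adicCompletion K)ˣ → w.adicCompletion K) (fun u => ((ν u : ℂˣ) : ℂ)) 0 y ∂μ) := by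
  rw [lFactor_of_not K w (not_isUnramifiedChar_of_exact_conductor ν hc1 hνmin), one_mul]
  exact setIntegral_compl_tail_mul_addChar_mul_inv_eq_gaussShell μ ν hν hc1 hνc hνmin (C₀ s) (he s hs) (T s) (hT s)
    (continuous_of_hasConductorExp hcψ) hcψ σ κ hc (by omega)

omit [MeasurableSpace (w.adicCompletion K)] [BorelSpace (w.adicCompletion K)] in
/-- **`hΓreg` AT A RAMIFIED PLACE**: `s ↦ C₀ s · (q_w^{−(ae s + ce − 2)})^k · G` is regular at `s₀` when `C₀` is (a Laurent monomial in `q_w^{−s}` times constants).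
[cite: Casselman1980, §3] [cite: KudlaSweet1997, §1] -/
theorem isQRationalRegularAt_gammaRam (ae : ℕ) (ce : ℂ) {C₀ : ℂ → ℂ} {s₀ : ℂ}
    (hC₀ : IsQRationalRegularAt (residueFieldCard (w.adicCompletion K)) s₀ C₀) (k : ℤ) (G : ℂ) :
    IsQRationalRegularAt (residueFieldCard (w.adicCompletion K)) s₀ fun s =>
      C₀ s * ((residueFieldCard (w.adicCompletion K) : ℂ) ^ (-((ae : ℂ) * s + ce - 2))) ^ k * G := by
  have hq0 : (residueFieldCard (w.adicCompletion K) : ℂ) ≠ 0 := Nat.cast_ne_zero.2 (residueFieldCard_ne_zero _)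
  have hY : IsQRationalRegularAt (residueFieldCard (w.adicCompletion K)) s₀ fun s =>
      (residueFieldCard (w.adicCompletion K) : ℂ) ^ (-((ae : ℂ) * s + ce - 2)) :=
    (isQRationalRegularAt_cpow_one_sub_of_affine (K := K) (w := w) (e := fun s => (ae : ℂ) * s + (ce - 1)) ae (ce - 1) (fun _ => rfl) s₀).congr
      fun s => by
        show (residueFieldCard (w.adicCompletion K) : ℂ) ^ (1 - ((ae : ℂ) * s + (ce - 1))) = _
        rw [show (1 : ℂ) - ((ae : ℂ) * s + (ce - 1)) = -((ae : ℂ) * s + ce - 2) by ring]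
  have hY0 : (residueFieldCard (w.adicCompletion K) : ℂ) ^ (-((ae : ℂ) * s₀ + ce - 2)) ≠ 0 := Complex.cpow_ne_zero_iff.2 (Or.inl hq0)
  exact (hC₀.mul (isQRationalRegularAt_zpow hY hY0 k)).mul (isQRationalRegularAt_const _ s₀ G)

/-- **`hΓ0` AT A RAMIFIED PLACE**: `C₀ s₀ · (q_w^{−(e(s₀)−2)})^{c_ψ−j_c−c_ν} · G_c ≠ 0` whenever `C₀ s₀ ≠ 0` (`G_c ≠ 0`: ★ p863371 `gammaRamified_ne_zero`, Tate's Lemma 2.4.3) — at EVERY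
`s₀`: no zero and no pole at a ramified place. [cite: Tate1950, §2.5, Lemma 2.4.3] [cite: GanTakeda2011SiegelWeil, §7 Lemma 7.4] -/
theorem gammaRam_ne_zero (ν : (w.adicCompletion K)ˣ →* ℂˣ) {cν : ℕ} (hc1 : 1 ≤ cν)
    (hνc : ∀ u ∈ unitFiltration (w.adicCompletion K) cν, ν u = 1) (hνmin : ∀ b < cν, ∃ u ∈ unitFiltration (w.adicCompletion K) b, ν u ≠ 1)
    (ae : ℕ) (ce : ℂ) {ψ : AddChar (w.adicCompletion K) Circle} {cψ : ℤ} (hcψ : ψ.HasConductorExp cψ) (σ κ : w.adicCompletion K) {jc : ℤ}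
    (hc : normAbs (w.adicCompletion K) (σ * κ) = (residueFieldCard (w.adicCompletion K) : ℝ≥0)⁻¹ ^ jc)
    {C₀ : ℂ → ℂ} {s₀ : ℂ} (hC₀0 : C₀ s₀ ≠ 0) :
    C₀ s₀ * ((residueFieldCard (w.adicCompletion K) : ℂ) ^ (-((ae : ℂ) * s₀ + ce - 2))) ^ (cψ - jc - cν) *
        ∫ y in primePowBall (w.adicCompletion K) (cψ - jc - cν) \ primePowBall (w.adicCompletion K) (cψ - jc - cν + 1),
          ((ψ (σ * κ * y)) : ℂ) * Function.extend ((↑) : (w.adicCompletion K)ˣ → w.adicCompletion K) (fun u => ((ν u : ℂˣ) : ℂ)) 0 y ∂μ ≠ 0 :=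
  gammaRamified_ne_zero μ ν hc1 hνc hνmin (continuous_of_hasConductorExp hcψ) hcψ hc hC₀0 ((ae : ℂ) * s₀ + ce)

/-! ## §4 THE PACKAGE: W-FE-3's evaluation letter at every finite place -/

/-- **THE Γ-LETTER OF THE RANK-ONE ψ-WHITTAKER FUNCTIONAL EQUATION EXISTS AT EVERY FINITE PLACE.**  From EXACTLY ★ W-FE-3's binders — `ν` unitary, the affine exponent
`e(s) = ae·s + ce` with `1 < re s → 1 < re e(s)`, the tail coefficient `C₀`, the tail letter `T` (`hT`), the conductor letter `(cν, hνc)` of `ν`, `ψ` of conductor exponent `c_ψ` —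
plus the four scalars the `U(2,2)_v` instantiation knows: `hc : ‖σκ‖ = q_w⁻¹^{j_c}`, `C₀` regular at `½` and `C₀(½) ≠ 0`, and `e(½) = 1` (the rank-one step sits at the centre):
**`∃ Γt N₀, (∀ M ≥ N₀, ∀ s, 1 < re s → ∫_{x ∉ 𝔭^M} T s x · ψ(σ(κx⁻¹)) dμ = lFactor K w ν (e(s) − 1) · Γt s) ∧ IsQRationalRegularAt q_w ½ Γt ∧ Γt ½ ≠ 0`** — by cases on the conductor
exponent of `ν` (★ `QuasiChar.exists_hasConductorExp`): unramified ⇒ §2, ramified ⇒ §3.  This is the `(Γt, N₀, hΓ, hΓreg, hΓ0)` of the `hN₃` producer `K2LiuLocalKernelN3OfGammaLetter`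
(LH7-p06 (g2)) with `q₀ = q_w`. [cite: Tate1950, §2.5] [cite: CasselmanShalika1980, §4] [cite: Casselman1980, §3] [cite: GanTakeda2011SiegelWeil, §7 Lemma 7.4] -/
theorem exists_gammaLetter
    (ν : (w.adicCompletion K)ˣ →* ℂˣ) (hν : ∀ x, ‖((ν x : ℂˣ) : ℂ)‖ = 1)
    (ae : ℕ) (ce : ℂ) (he : ∀ s : ℂ, 1 < s.re → 1 < ((ae : ℂ) * s + ce).re) (C₀ : ℂ → ℂ)
    (T : ℂ → w.adicCompletion K → ℂ)
    (hT : ∀ (s : ℂ) (x : (w.adicCompletion K)ˣ), T s x = C₀ s * (((ν x)⁻¹ : ℂˣ) : ℂ) *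
      ((normAbs (w.adicCompletion K) (x : w.adicCompletion K) : ℝ) : ℂ) ^ (-((ae : ℂ) * s + ce)))
    (cν : ℤ)
    (hνc : ∀ x : (w.adicCompletion K)ˣ, normAbs (w.adicCompletion K) (x : w.adicCompletion K) = 1 →
      (x : w.adicCompletion K) - 1 ∈ primePowBall (w.adicCompletion K) cν → ν x = 1)
    {ψ : AddChar (w.adicCompletion K) Circle} {cψ : ℤ} (hcψ : ψ.HasConductorExp cψ) (σ κ : w.adicCompletion K) {jc : ℤ}
    (hc : normAbs (w.adicCompletion K) (σ * κ) = (residueFieldCard (w.adicCompletion K) : ℝ≥0)⁻¹ ^ jc)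
    (hC₀reg : IsQRationalRegularAt (residueFieldCard (w.adicCompletion K)) (1 / 2) C₀) (hC₀0 : C₀ (1 / 2) ≠ 0)
    (he0 : (ae : ℂ) * (1 / 2) + ce = 1) :
    ∃ (Γt : ℂ → ℂ) (N₀ : ℤ),
      (∀ M : ℤ, N₀ ≤ M → ∀ s : ℂ, 1 < s.re →
        ∫ x in (primePowBall (w.adicCompletion K) M)ᶜ, T s x * ((ψ (σ * (κ * x⁻¹)) : ℂ)) ∂μ = lFactor K w ν ((ae : ℂ) * s + ce - 1) * Γt s) ∧
      IsQRationalRegularAt (residueFieldCard (w.adicCompletion K)) (1 / 2) Γt ∧ Γt (1 / 2) ≠ 0 := by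
  -- `ν` is continuous; take its conductor exponent
  have hcont : Continuous ν := continuous_of_conductor_letter ν cν hνc
  obtain ⟨c, hcex⟩ := QuasiChar.exists_hasConductorExp (⟨ν, hcont⟩ : QuasiChar (w.adicCompletion K))
  have hc_1 : ∀ u ∈ unitFiltration (w.adicCompletion K) c, ν u = 1 := fun u hu => hcex.1 u hu
  have hc_2 : ∀ b < c, ∃ u ∈ unitFiltration (w.adicCompletion K) b, ν u ≠ 1 := fun b hb => hcex.2 b hb
  rcases Nat.eq_zero_or_pos c with hc0 | hc1
  · -- unramified
    subst hc0
    have hun : IsUnramifiedChar ν :=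
      (isUnramifiedChar_iff_normAbs ν).2 fun u hu => hc_1 u (TateDirect.mem_unitFiltration_zero_iff.2 hu)
    refine ⟨fun s => C₀ s * (μ.real (primePowBall (w.adicCompletion K) 0) : ℂ) *
        (unramValue K w ν * (residueFieldCard (w.adicCompletion K) : ℂ) ^ (1 - ((ae : ℂ) * s + ce))) ^ (cψ - jc - 1) *
        (unramValue K w ν * (residueFieldCard (w.adicCompletion K) : ℂ) ^ (1 - ((ae : ℂ) * s + ce)) - (residueFieldCard (w.adicCompletion K) : ℂ)⁻¹),
      jc + 2 - cψ, fun M hM s hs => ?_, isQRationalRegularAt_gammaUnram ν hun ae ce hC₀reg _ _, gammaUnram_ne_zero μ ν hν hun ae ce hC₀0 he0 _⟩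
    exact setIntegral_compl_tail_eq_lFactor_mul_of_isUnramifiedChar μ ν hν hun ae ce he C₀ T hT hcψ σ κ hc hM hs
  · -- ramified, exact conductor exponent `c ≥ 1`
    refine ⟨fun s => C₀ s * ((residueFieldCard (w.adicCompletion K) : ℂ) ^ (-((ae : ℂ) * s + ce - 2))) ^ (cψ - jc - c) *
        ∫ y in primePowBall (w.adicCompletion K) (cψ - jc - c) \ primePowBall (w.adicCompletion K) (cψ - jc - c + 1),
          ((ψ (σ * κ * y)) : ℂ) * Function.extend ((↑) : (w.adicCompletion K)ˣ → w.adicCompletion K) (fun u => ((ν u : ℂˣ) : ℂ)) 0 y ∂μ,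
      jc + c + 1 - cψ, fun M hM s hs => ?_, isQRationalRegularAt_gammaRam ae ce hC₀reg _ _,
      gammaRam_ne_zero μ ν hc1 hc_1 hc_2 ae ce hcψ σ κ hc hC₀0⟩
    exact setIntegral_compl_tail_eq_lFactor_mul_of_ramified μ ν hν hc1 hc_1 hc_2 ae ce he C₀ T hT hcψ σ κ hc hM hs

end Summit.HodgeConjecture.HodgeConjecture.Cruxes.HLiu418.K2LiuRankOneWhittakerGammaLetterKw

end
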